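/-
Copyright: the b2b-balaban T⁴-continuum CRUX team, row NE7b OWNER lineage `t4-ne7b-p1` (gen 125). Project licence.
-/
import Summits.QuantumFields.BalabanUV.T4Continuum.Spine.NE7b.SupZdPerturbedDataAgreement
import Summits.QuantumFields.BalabanUV.T4Continuum.Spine.NE7b.SupZdPerturbedTorusLift

/-!
# THE SEAM ESTIMATE FOR THE PERTURBED BLOCK COLUMNS AND COARSE OPERATORS: for `V : ℤ^d → [−λ, Λ]`, a kernel `|K(p,q)| ≤ εe^{−γ|p−q|₁}`,
# a torus solution `ψ` of the `H[V∘wm] + K(wm·, wm·)` block-column equation for a deep coarse centre `c` on the fine torus of coarse period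
# `3^k`, and ANY decaying `ℤ^d` solution `Φ` of `(H_V + K)Φ = 𝟙_{B n c}`: `|ψ(σ p) − Φ(p)| ≤ C_∞εK_γC_Φe^{−μR_k(c)} + C_∞′e^{−(μ∕2)R_k(blk n p)}`
# with the DEPTHS `R_k(b) = 3^k∕2 − 2 − |b|₁`, and for deep `b` the torus coarse entry `T^{tor}_K(σ b, σ c)` is within the same bound of
# `T_K(b,c) = (n+1)^{−d}Σ_{q ∈ B n b}Φ(q)` — (238)'s two truncated-kernel equations fed to (237)'s near data agreement on the deep blocks.
# The input (5.9) of [B4] Sect. 5 for the torus → `ℤ^d` limit of the perturbed next-scale Hessian (row NE7b, node U5c; (237)∕(238) BY NAME;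
# [folklore])

Cell `pub-balaban`, sub-cell `t4`, spine estimate NE7b (`T4WeightBudget.RelWeightBound`; the cell's OWN estimate — NOT PRINTED in
[Bałaban 1983–89], NOT PROVED).  Crux-route work under `Spine/NE7b/` by the row OWNER (`t4-ne7b-p1` gen 125, file (239)) under FREEZE
(0)'s crux-prover clause; NOTHING of Bałaban's is named as a Lean object, valued or asserted; no `T4Continuum/Support` leaf typed; no `def`,
no notation (torus and `ℤ^d` operators DISPLAYED; `ψ`, `Φ` are ANY solutions with the displayed bounds); zero `sorry`.  Imports (BY NAME):
the OWNER's (237) `…SupZdPerturbedDataAgreement` (`zd_perturbed_data_agreement`), (238) `…SupZdPerturbedTorusLift` (`lift_truncated_equation`,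
`column_truncated_equation`, `torus_coarse_entry_reading`, `nonwindow_block_far`; through it (197) `windowMap_siteOf_of_deep`,
`windowMap_siteOf_of_deep_block`, `depth_le_dist`, (222) `K_pos`, (27) `mem_B`, `sum_B_const`).

WHY (located).  (197) proved the seam estimate of the LINEAR column from (185) (exact lift) + (196) (data agreement).  For `H + K` the lift
is exact only for the periodically read truncated kernel; (238) rewrote both the lift and the `ℤ^d` column as solutions of ONE `ℤ^d` equation
with the truncated kernel `K^W` and sources `𝟙̃ + g₁` (defect off the window) and `𝟙 + g₂` (defect `≤ εK_γC_Φe^{−μR_k(c)}` everywhere), and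
(237) turns «potentials equal and sources `η`-close on the deep blocks» into «solutions `C_∞η + C_∞′e^{−(μ∕2)D}`-close at depth `D`».  On a deep
block `wm σ p = p` ((197)), so the window potential reads `V`, `g₁ = 0`, and the torus block source `𝟙[σ(blk n (wm σp)) = σ c]` IS `𝟙[blk n p = c]`
(both `blk n p` and `c` are coarse window points, on which `σ` is injective); the depth `D = R_k(blk n p)` is (197)'s `depth_le_dist`.

WHAT IS PROVED ([folklore]): §1 `deep_blockSource_reading` (the two block sources agree on deep blocks for a deep centre); §2 THE END
**`zd_perturbed_coarse_seam`** (`∃ C₀ C_P δ₀ > 0` ((237)'s): for ALL `n, k`, `V`, rates∕sizes under the two smallness conditions, kernels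
of the class, deep centres `c`, ANY bounded torus column `ψ` and ANY decaying `ℤ^d` column `Φ`: (i) the pointwise seam bound at every
`p ∈ ℤ^d`; (ii) the coarse-entry seam bound for every deep row `b`); §3 toy.

HONEST (what this is NOT).  A two-depth bound (row depth through `D`, column depth through `η`); the row-only form needed by [B4] (5.9)
follows with the entries' own decay (the sequel, with Hyp56 on the torus and (5.10)); scalar skeleton ((A3), NC-NE7b-α UNRULED); nothing
of the covariant propagators of [B4]–[B6]; nothing of Bałaban's asserted.  BY-NAME EFFECT ON THE WALL: NONE.  NE7b NOT PRINTED ∕ NOT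
PROVED; spine PROVED 0∕9; rung (B)+1 — the programme's measures remain FINITE-torus statements; NOT the mass gap, NOT Clay.  HONEST
DEPENDENCY: continuum YM on T⁴ ⇐ BetaPertH ∧ nine spine estimates (0∕9 proved); BetaPertH ⇐ (D1) ∧ (D4) ∧ CAP+tail; G-an2-4 gates
asym, D1 and NE2∕3∕4.
-/

set_option autoImplicit false

noncomputable section

namespace Summit.QuantumFields.BalabanUV.T4Continuum.NE7b.SupZdPerturbedCoarseTorusSeam

open Real Filter Topology
open Literature.MathematicalPhysics.QuantumFieldTheory.Balaban1983to89
open B6QGQLower276 (X e blk B chart mem_B sum_B sum_B_const blk_chart)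
open Beta (Site siteOf windowMap siteOf_windowMap)
open SupZdPerturbedColumn (K_pos)
open SupZdCoarseTorusSeam (windowMap_siteOf_of_deep windowMap_siteOf_of_deep_block depth_le_dist)
open SupZdPerturbedDataAgreement (zd_perturbed_data_agreement)
open SupZdPerturbedTorusLift (lift_truncated_equation column_truncated_equation torus_coarse_entry_reading nonwindow_block_far)

variable {d : ℕ}

/-! ## §1. On deep blocks the torus block source is the `ℤ^d` block source -/

/-- **DEEP BLOCK SOURCES AGREE**: for a deep coarse centre `c` and a fine point `p` in a deep block,
`σ_k(blk n (wm(σ p))) = σ_k c ↔ blk n p = c` — `wm σ p = p`, and `σ_k` is injective on coarse window points. [folklore] -/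
theorem deep_blockSource_reading (n k : ℕ) (c p : X d) (hc : ∀ i, 2 * |c i| + 4 < ((3 ^ k : ℕ) : ℤ))
    (hp : ∀ i, 2 * |blk n p i| + 4 < ((3 ^ k : ℕ) : ℤ)) :
    (siteOf d (3 ^ k) (blk n (windowMap d ((n + 1) * 3 ^ k) (siteOf d ((n + 1) * 3 ^ k) p))) = siteOf d (3 ^ k) c) ↔ blk n p = c := by
  rw [windowMap_siteOf_of_deep_block n k p hp]
  constructor
  · intro h
    have h' := congrArg (windowMap d (3 ^ k)) h
    rwa [windowMap_siteOf_of_deep k (blk n p) hp, windowMap_siteOf_of_deep k c hc] at h'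
  · intro h; rw [h]

/-! ## §2. THE END: the seam estimate -/

/-- **HEADLINE — THE SEAM ESTIMATE FOR THE `H + K` COLUMN.**  `d ≥ 3`, `a > 0`, `λ < min(2,a)`, `Λ ≥ 0` ⟹ `∃ C₀ C_P δ₀ > 0` (from
`(d, a, λ, Λ)`) such that for ALL `n, k`, `V : ℤ^d → [−λ, Λ]`, rates `0 < μ < min(δ₀, γ)`, sizes `ε ≥ 0` under the two smallness conditions,
kernels `|K(p,q)| ≤ εe^{−γ|p−q|₁}`, DEEP centres `c` (`2|c i| + 4 < 3^k`), ANY torus function `|ψ| ≤ B_u` solving the torus block-column equation of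
`H[V∘wm] + K(wm·,wm·)` for the coarse site `σ c`, and ANY `ℤ^d` function `|Φ(q)| ≤ C_Φe^{−μ|blk n q − c|₁}` solving `(H_V + K)Φ = 𝟙[blk n · = c]`: with
`C_∞ = 2C_PK_{δ₀−μ}K_{μ∕2}`, `M = 1 + 2εK_γ(B_u + C_Φ)`, `R_k(b) = 3^k∕2 − 2 − |b|₁`:
(i) `|ψ(σ p) − Φ(p)| ≤ C_∞·εK_γC_Φe^{−μR_k(c)} + C_∞(2 + 2(|λ|+Λ)C_∞)M·e^{−(μ∕2)R_k(blk n p)}` at EVERY `p ∈ ℤ^d`;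
(ii) for every deep `b`: `|(n+1)^{−d}Σ_zψ(σ(chart n (wm σ b) z)) − (n+1)^{−d}Σ_{q ∈ B n b}Φ(q)| ≤` the same with `R_k(b)`. [folklore] -/
theorem zd_perturbed_coarse_seam (hd : 3 ≤ d) (a : ℝ) (ha : 0 < a) {lam Lam : ℝ} (hlam : lam < min 2 a) (hLam : 0 ≤ Lam) :
    ∃ C₀ CP δ₀ : ℝ, 0 < C₀ ∧ 0 < CP ∧ 0 < δ₀ ∧ ∀ (n k : ℕ) (V : X d → ℝ), (∀ p, -lam ≤ V p) → (∀ p, V p ≤ Lam) →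
      ∀ (ε γ μ : ℝ), 0 ≤ ε → 0 < μ → μ < δ₀ → μ < γ →
      ε * (2 * (1 - exp (-γ))⁻¹) ^ d * C₀ ≤ 1 / 2 →
      (CP * (2 * (1 - exp (-(δ₀ - μ)))⁻¹) ^ d) * (ε * exp (μ * d) * (2 * (1 - exp (-(γ - μ)))⁻¹) ^ d) ≤ 1 / 2 →
      ∀ (K : X d → X d → ℝ), (∀ p q, |K p q| ≤ ε * exp (-(γ * ∑ i, (((p i - q i).natAbs : ℕ) : ℝ)))) →
      ∀ (c : X d), (∀ i, 2 * |c i| + 4 < ((3 ^ k : ℕ) : ℤ)) →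
      ∀ (ψ : Site d ((n + 1) * 3 ^ k) → ℝ) (Bu : ℝ), (∀ x, |ψ x| ≤ Bu) →
      (∀ x, ((n : ℝ) + 1) ^ 2 * ∑ μ', (2 * ψ x - ψ (x + siteOf d ((n + 1) * 3 ^ k) (e μ')) - ψ (x - siteOf d ((n + 1) * 3 ^ k) (e μ')))
        + a / ((n : ℝ) + 1) ^ d * ∑ q ∈ B n (blk n (windowMap d ((n + 1) * 3 ^ k) x)), ψ (siteOf d ((n + 1) * 3 ^ k) q)
        + V (windowMap d ((n + 1) * 3 ^ k) x) * ψ x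
        + ∑ z, K (windowMap d ((n + 1) * 3 ^ k) x) (windowMap d ((n + 1) * 3 ^ k) z) * ψ z
        = if siteOf d (3 ^ k) (blk n (windowMap d ((n + 1) * 3 ^ k) x)) = siteOf d (3 ^ k) c then 1 else 0) →
      ∀ (Φ : X d → ℝ) (CΦ : ℝ), (∀ q, |Φ q| ≤ CΦ * exp (-(μ * ∑ i, (((blk n q i - c i).natAbs : ℕ) : ℝ)))) →
      (∀ p, ((n : ℝ) + 1) ^ 2 * ∑ μ', (2 * Φ p - Φ (p + e μ') - Φ (p - e μ'))
        + a / ((n : ℝ) + 1) ^ d * ∑ q ∈ B n (blk n p), Φ q + V p * Φ p + ∑' q : X d, K p q * Φ q = if blk n p = c then 1 else 0) →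
      (∀ p : X d, |ψ (siteOf d ((n + 1) * 3 ^ k) p) - Φ p|
        ≤ (2 * (CP * (2 * (1 - exp (-(δ₀ - μ)))⁻¹) ^ d) * (2 * (1 - exp (-(μ / 2)))⁻¹) ^ d)
            * (ε * (2 * (1 - exp (-γ))⁻¹) ^ d * (CΦ * exp (-(μ * (((3 ^ k : ℕ) : ℝ) / 2 - 2 - ∑ j, (((c j).natAbs : ℕ) : ℝ))))))
          + (2 * (CP * (2 * (1 - exp (-(δ₀ - μ)))⁻¹) ^ d) * (2 * (1 - exp (-(μ / 2)))⁻¹) ^ d)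
            * ((2 + 2 * (|lam| + Lam) * (2 * (CP * (2 * (1 - exp (-(δ₀ - μ)))⁻¹) ^ d) * (2 * (1 - exp (-(μ / 2)))⁻¹) ^ d))
              * (1 + 2 * (ε * (2 * (1 - exp (-γ))⁻¹) ^ d) * (Bu + CΦ)))
            * exp (-(μ / 2 * (((3 ^ k : ℕ) : ℝ) / 2 - 2 - ∑ j, (((blk n p j).natAbs : ℕ) : ℝ))))) ∧
      (∀ b : X d, (∀ i, 2 * |b i| + 4 < ((3 ^ k : ℕ) : ℤ)) →
        |(((n : ℝ) + 1) ^ d)⁻¹ * ∑ z : Fin d → Fin (n + 1),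
            ψ (siteOf d ((n + 1) * 3 ^ k) (chart n (windowMap d (3 ^ k) (siteOf d (3 ^ k) b)) z))
          - (((n : ℝ) + 1) ^ d)⁻¹ * ∑ q ∈ B n b, Φ q|
        ≤ (2 * (CP * (2 * (1 - exp (-(δ₀ - μ)))⁻¹) ^ d) * (2 * (1 - exp (-(μ / 2)))⁻¹) ^ d)
            * (ε * (2 * (1 - exp (-γ))⁻¹) ^ d * (CΦ * exp (-(μ * (((3 ^ k : ℕ) : ℝ) / 2 - 2 - ∑ j, (((c j).natAbs : ℕ) : ℝ))))))
          + (2 * (CP * (2 * (1 - exp (-(δ₀ - μ)))⁻¹) ^ d) * (2 * (1 - exp (-(μ / 2)))⁻¹) ^ d)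
            * ((2 + 2 * (|lam| + Lam) * (2 * (CP * (2 * (1 - exp (-(δ₀ - μ)))⁻¹) ^ d) * (2 * (1 - exp (-(μ / 2)))⁻¹) ^ d))
              * (1 + 2 * (ε * (2 * (1 - exp (-γ))⁻¹) ^ d) * (Bu + CΦ)))
            * exp (-(μ / 2 * (((3 ^ k : ℕ) : ℝ) / 2 - 2 - ∑ j, (((b j).natAbs : ℕ) : ℝ))))) := by
  classical
  obtain ⟨C₀, CP, δ₀, hC₀, hCP, hδ₀, H237⟩ := zd_perturbed_data_agreement (d := d) hd a ha hlam hLam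
  refine ⟨C₀, CP, δ₀, hC₀, hCP, hδ₀, ?_⟩
  intro n k V hV hV' ε γ μ hε hμ hμδ hμγ hs1 hs2 K hK c hc ψ Bu hψB hψ Φ CΦ hΦB hΦ
  have hγ : 0 < γ := hμ.trans hμγ
  have hK0 : 0 < (2 * (1 - exp (-(δ₀ - μ)))⁻¹) ^ d := K_pos (d := d) (sub_pos.2 hμδ)
  have hKh : 0 < (2 * (1 - exp (-(μ / 2)))⁻¹) ^ d := K_pos (d := d) (by linarith)
  have hKγ : 0 < (2 * (1 - exp (-γ))⁻¹) ^ d := K_pos (d := d) hγ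
  obtain ⟨Cs, hCs⟩ : ∃ Cs : ℝ, Cs = 2 * (CP * (2 * (1 - exp (-(δ₀ - μ)))⁻¹) ^ d) * (2 * (1 - exp (-(μ / 2)))⁻¹) ^ d := ⟨_, rfl⟩
  obtain ⟨Kγ, hKγd⟩ : ∃ Kγ : ℝ, Kγ = (2 * (1 - exp (-γ))⁻¹) ^ d := ⟨_, rfl⟩
  have hCs0 : 0 < Cs := by rw [hCs]; positivity
  have hKγ0 : 0 < Kγ := by rw [hKγd]; exact hKγ
  have hV₁ : ∀ p : X d, -lam ≤ V (windowMap d ((n + 1) * 3 ^ k) (siteOf d ((n + 1) * 3 ^ k) p)) := fun p => hV _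
  have hV₁' : ∀ p : X d, V (windowMap d ((n + 1) * 3 ^ k) (siteOf d ((n + 1) * 3 ^ k) p)) ≤ Lam := fun p => hV' _
  have H := H237 n (fun p => V (windowMap d ((n + 1) * 3 ^ k) (siteOf d ((n + 1) * 3 ^ k) p))) V hV₁ hV₁' hV hV' ε γ μ hε hμ hμδ hμγ
    hs1 hs2
  simp only [← hCs] at H
  rw [← hCs, ← hKγd]
  have hBu : 0 ≤ Bu := (abs_nonneg _).trans (hψB 0)
  have hCΦ : 0 ≤ CΦ := by
    have h := (abs_nonneg _).trans (hΦB c)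
    exact le_of_mul_le_mul_right (by rw [zero_mul]; exact h) (exp_pos _)
  have hΦb : ∀ q, |Φ q| ≤ CΦ := fun q =>
    (hΦB q).trans (mul_le_of_le_one_right hCΦ (exp_le_one_iff.2 (by rw [neg_nonpos]; positivity)))
  -- the two truncated-kernel equations ((238))
  obtain ⟨g₁, hg₁W, hg₁B, hu₁⟩ := lift_truncated_equation n a (3 ^ k) hγ K hK (fun x => V (windowMap d ((n + 1) * 3 ^ k) x)) ψ
    (fun x => if siteOf d (3 ^ k) (blk n (windowMap d ((n + 1) * 3 ^ k) x)) = siteOf d (3 ^ k) c then (1 : ℝ) else 0) hψB hψ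
  obtain ⟨hu₂, hg₂B⟩ := column_truncated_equation n a ((n + 1) * 3 ^ k) hγ K hK V Φ (fun p => if blk n p = c then (1 : ℝ) else 0)
    hΦb hΦ
  have hη := hg₂B c CΦ μ (((3 ^ k : ℕ) : ℝ) / 2 - 2 - ∑ j, (((c j).natAbs : ℕ) : ℝ)) hμ.le hΦB (fun q hq => nonwindow_block_far n k q c hq)
  rw [← hKγd] at hg₁B hη
  -- the data for (237)
  have hM0 : (1 : ℝ) ≤ 1 + 2 * (ε * Kγ) * (Bu + CΦ) := le_add_of_nonneg_right (by positivity)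
  have hf₁ : ∀ p : X d, |(if siteOf d (3 ^ k) (blk n (windowMap d ((n + 1) * 3 ^ k) (siteOf d ((n + 1) * 3 ^ k) p))) = siteOf d (3 ^ k) c
      then (1 : ℝ) else 0) + g₁ p| ≤ 1 + 2 * (ε * Kγ) * (Bu + CΦ) := by
    intro p
    refine (abs_add_le _ _).trans (add_le_add (by split_ifs <;> simp) ((hg₁B p).trans ?_))
    nlinarith [mul_nonneg (mul_nonneg hε hKγ0.le) hCΦ]
  have hf₂ : ∀ p : X d, |(if blk n p = c then (1 : ℝ) else 0)
      + -∑' q : X d, (if windowMap d ((n + 1) * 3 ^ k) (siteOf d ((n + 1) * 3 ^ k) q) = q then 0 else K p q) * Φ q|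
      ≤ 1 + 2 * (ε * Kγ) * (Bu + CΦ) := by
    intro p
    have h0 := hg₂B c CΦ μ 0 hμ.le hΦB (fun q _ => by positivity) p
    rw [mul_zero, neg_zero, exp_zero, mul_one, ← hKγd] at h0
    refine (abs_add_le _ _).trans (add_le_add (by split_ifs <;> simp) (h0.trans ?_))
    nlinarith [mul_nonneg (mul_nonneg hε hKγ0.le) hBu, mul_nonneg (mul_nonneg hε hKγ0.le) hCΦ]
  -- on deep blocks the potentials agree and the sources are `η`-close
  have hA : ∀ p : X d, blk n p ∈ {b : X d | ∀ i, 2 * |b i| + 4 < ((3 ^ k : ℕ) : ℤ)} →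
      V (windowMap d ((n + 1) * 3 ^ k) (siteOf d ((n + 1) * 3 ^ k) p)) = V p ∧
      |((if siteOf d (3 ^ k) (blk n (windowMap d ((n + 1) * 3 ^ k) (siteOf d ((n + 1) * 3 ^ k) p))) = siteOf d (3 ^ k) c
          then (1 : ℝ) else 0) + g₁ p)
        - ((if blk n p = c then (1 : ℝ) else 0)
          + -∑' q : X d, (if windowMap d ((n + 1) * 3 ^ k) (siteOf d ((n + 1) * 3 ^ k) q) = q then 0 else K p q) * Φ q)|
        ≤ ε * Kγ * (CΦ * exp (-(μ * (((3 ^ k : ℕ) : ℝ) / 2 - 2 - ∑ j, (((c j).natAbs : ℕ) : ℝ))))) := by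
    intro p hp
    have hpW := windowMap_siteOf_of_deep_block n k p hp
    refine ⟨by rw [hpW], ?_⟩
    have hind : (if siteOf d (3 ^ k) (blk n (windowMap d ((n + 1) * 3 ^ k) (siteOf d ((n + 1) * 3 ^ k) p))) = siteOf d (3 ^ k) c
        then (1 : ℝ) else 0) = if blk n p = c then (1 : ℝ) else 0 := by
      simp only [deep_blockSource_reading n k c p hc hp]
    rw [hind, hg₁W p hpW]
    have e : (if blk n p = c then (1 : ℝ) else 0) + 0 - ((if blk n p = c then (1 : ℝ) else 0)
        + -∑' q : X d, (if windowMap d ((n + 1) * 3 ^ k) (siteOf d ((n + 1) * 3 ^ k) q) = q then 0 else K p q) * Φ q)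
        = -(-∑' q : X d, (if windowMap d ((n + 1) * 3 ^ k) (siteOf d ((n + 1) * 3 ^ k) q) = q then 0 else K p q) * Φ q) := by
      ring
    rw [e, abs_neg]
    exact hη p
  -- (237)
  have key := H (fun p q => if windowMap d ((n + 1) * 3 ^ k) (siteOf d ((n + 1) * 3 ^ k) q) = q then K p q else 0)
    (fun p q => (SupZdPerturbedTorusLift.truncated_kernel_decay ((n + 1) * 3 ^ k) K hK p q).1)
    (fun p => (if siteOf d (3 ^ k) (blk n (windowMap d ((n + 1) * 3 ^ k) (siteOf d ((n + 1) * 3 ^ k) p))) = siteOf d (3 ^ k) c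
      then (1 : ℝ) else 0) + g₁ p)
    (fun p => (if blk n p = c then (1 : ℝ) else 0)
      + -∑' q : X d, (if windowMap d ((n + 1) * 3 ^ k) (siteOf d ((n + 1) * 3 ^ k) q) = q then 0 else K p q) * Φ q)
    (1 + 2 * (ε * Kγ) * (Bu + CΦ)) hf₁ hf₂ (fun p => ψ (siteOf d ((n + 1) * 3 ^ k) p)) Φ Bu CΦ (fun p => hψB _) hΦb hu₁ hu₂
    {b : X d | ∀ i, 2 * |b i| + 4 < ((3 ^ k : ℕ) : ℤ)}
    (ε * Kγ * (CΦ * exp (-(μ * (((3 ^ k : ℕ) : ℝ) / 2 - 2 - ∑ j, (((c j).natAbs : ℕ) : ℝ)))))) (by positivity) hA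
  have hpt : ∀ p : X d, |ψ (siteOf d ((n + 1) * 3 ^ k) p) - Φ p|
      ≤ Cs * (ε * Kγ * (CΦ * exp (-(μ * (((3 ^ k : ℕ) : ℝ) / 2 - 2 - ∑ j, (((c j).natAbs : ℕ) : ℝ))))))
        + Cs * ((2 + 2 * (|lam| + Lam) * Cs) * (1 + 2 * (ε * Kγ) * (Bu + CΦ)))
          * exp (-(μ / 2 * (((3 ^ k : ℕ) : ℝ) / 2 - 2 - ∑ j, (((blk n p j).natAbs : ℕ) : ℝ)))) := fun p =>
    key p _ (fun c' hc' => depth_le_dist k (blk n p) c' (by simpa only [Set.mem_setOf_eq] using hc'))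
  refine ⟨hpt, fun b hb => ?_⟩
  -- (ii) the coarse entries: average (i) over the block `B n b`
  have hvol : (0 : ℝ) < ((n : ℝ) + 1) ^ d := by positivity
  rw [torus_coarse_entry_reading n k ψ b hb, ← mul_sub, ← Finset.sum_sub_distrib, abs_mul, abs_of_pos (inv_pos.2 hvol)]
  have hsum : ∑ q ∈ B n b, |ψ (siteOf d ((n + 1) * 3 ^ k) q) - Φ q|
      ≤ ∑ _q ∈ B n b, (Cs * (ε * Kγ * (CΦ * exp (-(μ * (((3 ^ k : ℕ) : ℝ) / 2 - 2 - ∑ j, (((c j).natAbs : ℕ) : ℝ))))))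
        + Cs * ((2 + 2 * (|lam| + Lam) * Cs) * (1 + 2 * (ε * Kγ) * (Bu + CΦ)))
          * exp (-(μ / 2 * (((3 ^ k : ℕ) : ℝ) / 2 - 2 - ∑ j, (((b j).natAbs : ℕ) : ℝ))))) :=
    Finset.sum_le_sum fun q hq => by have h := hpt q; rwa [mem_B.1 hq] at h
  rw [sum_B_const] at hsum
  calc (((n : ℝ) + 1) ^ d)⁻¹ * |∑ q ∈ B n b, (ψ (siteOf d ((n + 1) * 3 ^ k) q) - Φ q)|
      ≤ (((n : ℝ) + 1) ^ d)⁻¹ * ∑ q ∈ B n b, |ψ (siteOf d ((n + 1) * 3 ^ k) q) - Φ q| :=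
        mul_le_mul_of_nonneg_left (Finset.abs_sum_le_sum_abs _ _) (inv_nonneg.2 hvol.le)
    _ ≤ (((n : ℝ) + 1) ^ d)⁻¹ * (((n : ℝ) + 1) ^ d * (Cs * (ε * Kγ * (CΦ * exp (-(μ * (((3 ^ k : ℕ) : ℝ) / 2 - 2
          - ∑ j, (((c j).natAbs : ℕ) : ℝ))))))
        + Cs * ((2 + 2 * (|lam| + Lam) * Cs) * (1 + 2 * (ε * Kγ) * (Bu + CΦ)))
          * exp (-(μ / 2 * (((3 ^ k : ℕ) : ℝ) / 2 - 2 - ∑ j, (((b j).natAbs : ℕ) : ℝ)))))) :=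
        mul_le_mul_of_nonneg_left hsum (inv_nonneg.2 hvol.le)
    _ = _ := by field_simp

/-! ## §3. Toy -/

/-- Toy (`d = 3`, `a = 1`, `λ = 0`, `Λ = 1`): the constants of the seam estimate exist. -/
example : ∃ C₀ CP δ₀ : ℝ, 0 < C₀ ∧ 0 < CP ∧ 0 < δ₀ :=
  let ⟨C₀, CP, δ₀, h1, h2, h3, _⟩ := zd_perturbed_coarse_seam (d := 3) le_rfl 1 one_pos (lam := 0) (Lam := 1)
    (by rw [min_eq_right (by norm_num : (1 : ℝ) ≤ 2)]; norm_num) zero_le_one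
  ⟨C₀, CP, δ₀, h1, h2, h3⟩

end Summit.QuantumFields.BalabanUV.T4Continuum.NE7b.SupZdPerturbedCoarseTorusSeam
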